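import Summits.AtomisticToContinuum.HydrodynamicLimit.Theorems.CollisionIsometryCLTAdaptedWeightCLTBHPerContactGaussKL
import Summits.AtomisticToContinuum.HydrodynamicLimit.Theorems.CollisionIsometryCLTAdaptedWeightCLTBHPerContactKinematics
import Summits.AtomisticToContinuum.HydrodynamicLimit.Theorems.CollisionIsometryCLTAdaptedWeightCLTBHEntropyBudgetEntropy

/-!
# Per-contact inputs of the line `block-h-dissipation-closure` (crux `AdaptedWeightCLT`,
stmt-AtomisticToContinuum-14868; stub `stub_perContact`, `--supports`) — helper 4: the Bregman remainder of ONE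
contact in ONE cell, and its LONELY (universal) bound

For a post-collisional configuration `w`, a pair `i ≠ j` with pre-collisional configuration
`w⁰ = collidePair i j w`, a location `x` and the regularised cell laws `f̂ = cellLaw … w x`, `f̂⁰ = cellLaw … w⁰ x`
(`0 < δ ≤ 1`, `h > 0`, nonnegative kernel):
* the per-cell Bregman remainder IS an integral of the pointwise Bregman divergence:
  `H(f̂) − H(f̂⁰) − ∫ (1 + log f̂⁰)(f̂ − f̂⁰) = ∫ breg(f̂, f̂⁰) dv ≥ 0` (`cellBreg_eq`, `cellBreg_nonneg`; the
  `x`-integrand of `entS(w) − entS(w⁰) − incr(w⁰, w)` at `x` is `(N+1)⁻¹ W_x` times this);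
* JOINT CONVEXITY (log-sum, helper 1) through the common mixture structure
  `f̂ = (1−δ) W⁻¹ Σₖ cwₖ G_h(· − vₖ) + δ M_{θ̄+h²,ū}` (same weights before and after the contact, only the bumps
  of `i, j` and the floor move): pointwise
  `breg(f̂, f̂⁰) ≤ (1−δ) W⁻¹ (cwᵢ breg(Gᵢ, Gᵢ⁰) + cwⱼ breg(Gⱼ, Gⱼ⁰)) + δ breg(M, M⁰)` (`breg_cellLaw_le_pointwise`),
  hence, with the Gaussian relative entropies of helper 2,
  `∫ breg(f̂, f̂⁰) ≤ (1−δ) W⁻¹ (cwᵢ + cwⱼ) |vᵢ − vᵢ⁰|²/(2h²) + δ KL(M‖M⁰)` (`cellBreg_le_mixture`);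
* THE LONELY BOUND (valid at every cell, whatever the other particles do): with the kinematics of helper 3,
  `W · ∫ breg(f̂, f̂⁰) ≤ 5 (cwᵢ + cwⱼ) E₀ / h²`, `E₀ = |vᵢ⁰ − ū⁰|² + |vⱼ⁰ − ū⁰|²` the pair energy in the frame
  of the pre-collisional cell (`cW_mul_cellBreg_le_lonely`). No `log N`, no additive constant: a contact of slow
  (cell-frame) particles is cheap even when lonely; the populous gain `1/κ` is helper 5.
-/

namespace Summit.AtomisticToContinuum.HydrodynamicLimit.Theorems.BlockHDissipation

open scoped BigOperators Topology Classical MeasureTheory ENNReal InnerProductSpace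
open Filter Set MeasureTheory Real
open Literature.Analysis.FluidPDE
open Summit.AtomisticToContinuum.HydrodynamicLimit.Theorems.ContactSourceDuhamel (T3 V3 Cfg Vel Flow Flows)
open Literature.MathematicalPhysics.KineticTheory (localMaxwellian_pos localMaxwellian_nonneg continuous_localMaxwellian)

noncomputable section

namespace PerContact

open EntropyBudget

variable {N : ℕ} {ψ : ℕ → T3 → ℝ} {h δ : ℝ} (w : Cfg N) (x : T3) {i j : Fin (N + 1)}

local notation "𝕋G" => Torus.geometry (Fin 3)

/-! ## The per-cell Bregman remainder as an integral -/

/-- `(1 + log f̂⁰) · f̂'` is integrable for any two configurations (log bound of the cell law against the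
Gaussian-mixture moments). -/
theorem integrable_one_add_log_mul_cellLaw (hψ : ∀ y, 0 ≤ ψ N y) (hh : 0 < h) (hδ : 0 < δ) (hδ1 : δ ≤ 1)
    (w₀ w₁ : Cfg N) :
    Integrable fun v => (1 + log (cellLaw N ψ h δ w₀ x v)) * cellLaw N ψ h δ w₁ x v := by
  set Λ : ℝ := |Real.log ((2 * Real.pi * h ^ 2) ^ (-(3 : ℝ) / 2))| + |Real.log δ| +
    3 / 2 * |Real.log (2 * Real.pi * (cT N ψ w₀ x + h ^ 2))| with hΛ
  have hdom := integrable_cellLaw_mul_poly (δ := δ) w₁ x hψ hh (1 + Λ) (1 / (2 * h ^ 2)) (cU N ψ w₀ x) 2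
  refine hdom.mono' ?_ (Eventually.of_forall fun v => ?_)
  · exact ((measurable_const.add (Real.measurable_log.comp (continuous_cellLaw w₀ x).measurable)).mul
      (continuous_cellLaw w₁ x).measurable).aestronglyMeasurable
  · have hf := (cellLaw_pos w₁ x hψ hh hδ hδ1 v).le
    rw [norm_mul, Real.norm_eq_abs, Real.norm_eq_abs, abs_of_nonneg hf, mul_comm]
    refine mul_le_mul_of_nonneg_left ?_ hf
    have hl := abs_log_cellLaw_le (δ := δ) w₀ x hψ hh hδ hδ1 v
    calc |1 + log (cellLaw N ψ h δ w₀ x v)| ≤ 1 + |log (cellLaw N ψ h δ w₀ x v)| := by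
          refine (abs_add_le _ _).trans ?_; rw [abs_one]
      _ ≤ 1 + Λ + 1 / (2 * h ^ 2) * ‖v - cU N ψ w₀ x‖ ^ 2 := by rw [hΛ]; ring_nf at hl ⊢; linarith

/-- The first-order integrand `(1 + log f̂⁰)(f̂ − f̂⁰)` is integrable. -/
theorem integrable_incrIntegrand (hψ : ∀ y, 0 ≤ ψ N y) (hh : 0 < h) (hδ : 0 < δ) (hδ1 : δ ≤ 1) (w₀ w₁ : Cfg N) :
    Integrable fun v => (1 + log (cellLaw N ψ h δ w₀ x v)) * (cellLaw N ψ h δ w₁ x v - cellLaw N ψ h δ w₀ x v) := by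
  have h1 := integrable_one_add_log_mul_cellLaw x hψ hh hδ hδ1 w₀ w₁
  have h0 := integrable_one_add_log_mul_cellLaw x hψ hh hδ hδ1 w₀ w₀
  exact (h1.sub h0).congr (Eventually.of_forall fun v => by simp only [Pi.sub_apply]; ring)

/-- The pointwise Bregman divergence of two cell laws is integrable. -/
theorem integrable_breg_cellLaw (hψ : ∀ y, 0 ≤ ψ N y) (hh : 0 < h) (hδ : 0 < δ) (hδ1 : δ ≤ 1) (w₀ w₁ : Cfg N) :
    Integrable fun v => cellLaw N ψ h δ w₁ x v * (log (cellLaw N ψ h δ w₁ x v) - log (cellLaw N ψ h δ w₀ x v)) -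
      cellLaw N ψ h δ w₁ x v + cellLaw N ψ h δ w₀ x v := by
  have h1 := integrable_cellLaw_mul_log w₁ x hψ hh hδ hδ1
  have h0 := integrable_cellLaw_mul_log w₀ x hψ hh hδ hδ1
  have h2 := integrable_incrIntegrand x hψ hh hδ hδ1 w₀ w₁
  exact ((h1.sub h0).sub h2).congr (Eventually.of_forall fun v => by simp only [Pi.sub_apply]; ring)

/-- **THE PER-CELL BREGMAN REMAINDER IS `∫ breg(f̂, f̂⁰)`**:
`H(f̂) − H(f̂⁰) − ∫ (1 + log f̂⁰)(f̂ − f̂⁰) = ∫ (f̂ (log f̂ − log f̂⁰) − f̂ + f̂⁰) dv`. -/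
theorem cellBreg_eq (hψ : ∀ y, 0 ≤ ψ N y) (hh : 0 < h) (hδ : 0 < δ) (hδ1 : δ ≤ 1) (w₀ w₁ : Cfg N) :
    cellEnt N ψ h δ w₁ x - cellEnt N ψ h δ w₀ x -
        ∫ v, (1 + log (cellLaw N ψ h δ w₀ x v)) * (cellLaw N ψ h δ w₁ x v - cellLaw N ψ h δ w₀ x v) =
      ∫ v, (cellLaw N ψ h δ w₁ x v * (log (cellLaw N ψ h δ w₁ x v) - log (cellLaw N ψ h δ w₀ x v)) -
        cellLaw N ψ h δ w₁ x v + cellLaw N ψ h δ w₀ x v) := by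
  have h1 := integrable_cellLaw_mul_log w₁ x hψ hh hδ hδ1
  have h0 := integrable_cellLaw_mul_log w₀ x hψ hh hδ hδ1
  have h2 := integrable_incrIntegrand x hψ hh hδ hδ1 w₀ w₁
  have h10 : Integrable fun v => cellLaw N ψ h δ w₁ x v * log (cellLaw N ψ h δ w₁ x v) -
      cellLaw N ψ h δ w₀ x v * log (cellLaw N ψ h δ w₀ x v) := h1.sub h0
  unfold cellEnt
  rw [← integral_sub h1 h0, ← integral_sub h10 h2]
  refine integral_congr_ae (Eventually.of_forall fun v => ?_)
  ring

/-- The per-cell Bregman remainder is nonnegative. -/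
theorem cellBreg_nonneg (hψ : ∀ y, 0 ≤ ψ N y) (hh : 0 < h) (hδ : 0 < δ) (hδ1 : δ ≤ 1) (w₀ w₁ : Cfg N) :
    0 ≤ ∫ v, (cellLaw N ψ h δ w₁ x v * (log (cellLaw N ψ h δ w₁ x v) - log (cellLaw N ψ h δ w₀ x v)) -
        cellLaw N ψ h δ w₁ x v + cellLaw N ψ h δ w₀ x v) :=
  integral_nonneg fun v => breg_nonneg (cellLaw_pos w₁ x hψ hh hδ hδ1 v).le (cellLaw_pos w₀ x hψ hh hδ hδ1 v)

/-! ## Joint convexity through the mixture structure -/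

/-- The KDE as a sum with the weights inside: `f̃(v) = Σₖ (W⁻¹ cwₖ) G_h(v − vₖ)`. -/
theorem kde_eq_sum (w' : Cfg N) (v : V3) :
    kde N ψ h w' x v = ∑ k, (cW N ψ w' x)⁻¹ * cw N ψ w' x k * gauss h (w' k).2 v := by
  unfold kde
  rw [Finset.mul_sum]
  exact Finset.sum_congr rfl fun k _ => by ring

/-- **POINTWISE JOINT CONVEXITY ACROSS A CONTACT.** With `w⁰ = collidePair i j w`:
`breg(f̂(v), f̂⁰(v)) ≤ (1−δ) W⁻¹ (cwᵢ breg(Gᵢ(v), Gᵢ⁰(v)) + cwⱼ breg(Gⱼ(v), Gⱼ⁰(v))) + δ breg(M(v), M⁰(v))`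
(`G_k = G_h(· − v_k)`, `M = M_{θ̄+h²,ū}` of `w`, superscript `0` for `w⁰`). -/
theorem breg_cellLaw_le_pointwise (hψ : ∀ y, 0 ≤ ψ N y) (hh : 0 < h) (hδ : 0 ≤ δ) (hδ1 : δ ≤ 1) (hij : i ≠ j)
    (v : V3) :
    cellLaw N ψ h δ w x v * (log (cellLaw N ψ h δ w x v) - log (cellLaw N ψ h δ (collidePair 𝕋G i j w) x v)) -
        cellLaw N ψ h δ w x v + cellLaw N ψ h δ (collidePair 𝕋G i j w) x v ≤
      (1 - δ) * ((cW N ψ w x)⁻¹ *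
        (cw N ψ w x i * (gauss h (w i).2 v * (log (gauss h (w i).2 v) - log (gauss h ((collidePair 𝕋G i j w) i).2 v)) -
            gauss h (w i).2 v + gauss h ((collidePair 𝕋G i j w) i).2 v) +
          cw N ψ w x j * (gauss h (w j).2 v * (log (gauss h (w j).2 v) - log (gauss h ((collidePair 𝕋G i j w) j).2 v)) -
            gauss h (w j).2 v + gauss h ((collidePair 𝕋G i j w) j).2 v))) +
      δ * (localMaxwellian 1 (cT N ψ w x + h ^ 2) (cU N ψ w x) v *
          (log (localMaxwellian 1 (cT N ψ w x + h ^ 2) (cU N ψ w x) v) -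
            log (localMaxwellian 1 (cT N ψ (collidePair 𝕋G i j w) x + h ^ 2) (cU N ψ (collidePair 𝕋G i j w) x) v)) -
          localMaxwellian 1 (cT N ψ w x + h ^ 2) (cU N ψ w x) v +
          localMaxwellian 1 (cT N ψ (collidePair 𝕋G i j w) x + h ^ 2) (cU N ψ (collidePair 𝕋G i j w) x) v) := by
  set w₀ := collidePair 𝕋G i j w with hw₀
  have hM₁ : 0 < localMaxwellian 1 (cT N ψ w x + h ^ 2) (cU N ψ w x) v :=
    localMaxwellian_pos one_pos (theta_pos w x hψ hh) _ _
  have hM₀ : 0 < localMaxwellian 1 (cT N ψ w₀ x + h ^ 2) (cU N ψ w₀ x) v :=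
    localMaxwellian_pos one_pos (theta_pos w₀ x hψ hh) _ _
  have hcw : ∀ k, cw N ψ w₀ x k = cw N ψ w x k := fun k => by rw [hw₀, cw_collidePair]
  have hcW : cW N ψ w₀ x = cW N ψ w x := by rw [hw₀, cW_collidePair]
  -- the spectator sum reduces to `i` and `j`
  have hsum : ∑ k, cw N ψ w x k * (gauss h (w k).2 v * (log (gauss h (w k).2 v) - log (gauss h (w₀ k).2 v)) -
      gauss h (w k).2 v + gauss h (w₀ k).2 v) =
      cw N ψ w x i * (gauss h (w i).2 v * (log (gauss h (w i).2 v) - log (gauss h (w₀ i).2 v)) -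
        gauss h (w i).2 v + gauss h (w₀ i).2 v) +
      cw N ψ w x j * (gauss h (w j).2 v * (log (gauss h (w j).2 v) - log (gauss h (w₀ j).2 v)) -
        gauss h (w j).2 v + gauss h (w₀ j).2 v) :=
    Fintype.sum_eq_add i j hij fun k hk => by rw [hw₀, vel_collidePair_of_ne w hk.1 hk.2]; ring
  by_cases hS : cW N ψ w x = 0
  · -- empty cell: `f̂ = δ M`, pure floor
    have hS₀ : cW N ψ w₀ x = 0 := by rw [hcW, hS]
    have e1 : ∀ u, cellLaw N ψ h δ w x u = δ * localMaxwellian 1 (cT N ψ w x + h ^ 2) (cU N ψ w x) u := fun u => by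
      simp [cellLaw, kde_of_cW_eq_zero w x hS]
    have e0 : ∀ u, cellLaw N ψ h δ w₀ x u = δ * localMaxwellian 1 (cT N ψ w₀ x + h ^ 2) (cU N ψ w₀ x) u := fun u => by
      simp [cellLaw, kde_of_cW_eq_zero w₀ x hS₀]
    rw [e1, e0, hS, inv_zero, zero_mul, mul_zero, zero_add, breg_smul hδ hM₁.le hM₀]
  -- non-empty cell
  have hSpos : 0 < cW N ψ w x := lt_of_le_of_ne (cW_nonneg w x hψ) (Ne.symm hS)
  have hkde₀ : 0 < kde N ψ h w₀ x v := by
    rw [kde_eq_sum, hcW]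
    obtain ⟨k, hk⟩ : ∃ k, 0 < cw N ψ w x k := by
      by_contra hno
      simp only [not_exists, not_lt] at hno
      have : cW N ψ w x ≤ 0 := Finset.sum_nonpos fun k _ => hno k
      linarith
    refine Finset.sum_pos' (fun l _ => mul_nonneg (mul_nonneg (inv_nonneg.2 hSpos.le) (by rw [hcw]; exact cw_nonneg w x hψ l))
      (gauss_pos hh _ _).le) ⟨k, Finset.mem_univ k, ?_⟩
    rw [hcw]
    exact mul_pos (mul_pos (inv_pos.2 hSpos) hk) (gauss_pos hh _ _)
  -- step 1: the two-component mixture `(1−δ) f̃ + δ M`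
  have step1 := breg_mix_two_le (t₁ := 1 - δ) (t₂ := δ) (p₁ := kde N ψ h w x v)
    (p₂ := localMaxwellian 1 (cT N ψ w x + h ^ 2) (cU N ψ w x) v) (q₁ := kde N ψ h w₀ x v)
    (q₂ := localMaxwellian 1 (cT N ψ w₀ x + h ^ 2) (cU N ψ w₀ x) v) (by linarith) hδ (kde_nonneg w x hψ hh v)
    hM₁.le hkde₀ hM₀
  -- step 2: the KDE as a mixture with weights `W⁻¹ cw_k`
  have step2 : kde N ψ h w x v * (log (kde N ψ h w x v) - log (kde N ψ h w₀ x v)) - kde N ψ h w x v + kde N ψ h w₀ x v ≤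
      (cW N ψ w x)⁻¹ * ∑ k, cw N ψ w x k * (gauss h (w k).2 v * (log (gauss h (w k).2 v) - log (gauss h (w₀ k).2 v)) -
        gauss h (w k).2 v + gauss h (w₀ k).2 v) := by
    have h2 := breg_sum_smul_le (Finset.univ : Finset (Fin (N + 1))) (t := fun k => (cW N ψ w x)⁻¹ * cw N ψ w x k)
      (p := fun k => gauss h (w k).2 v) (q := fun k => gauss h (w₀ k).2 v)
      (fun k _ => mul_nonneg (inv_nonneg.2 hSpos.le) (cw_nonneg w x hψ k)) (fun k _ => (gauss_pos hh _ _).le)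
      (fun k _ => gauss_pos hh _ _)
    have ek1 : kde N ψ h w x v = ∑ k, (cW N ψ w x)⁻¹ * cw N ψ w x k * gauss h (w k).2 v := kde_eq_sum x w v
    have ek0 : kde N ψ h w₀ x v = ∑ k, (cW N ψ w x)⁻¹ * cw N ψ w x k * gauss h (w₀ k).2 v := by
      rw [kde_eq_sum x w₀ v, hcW]
      exact Finset.sum_congr rfl fun k _ => by rw [hcw]
    rw [ek1, ek0]
    refine h2.trans (le_of_eq ?_)
    rw [Finset.mul_sum]
    exact Finset.sum_congr rfl fun k _ => by ring
  rw [hsum] at step2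
  have hcell1 : cellLaw N ψ h δ w x v = (1 - δ) * kde N ψ h w x v + δ * localMaxwellian 1 (cT N ψ w x + h ^ 2) (cU N ψ w x) v := rfl
  have hcell0 : cellLaw N ψ h δ w₀ x v = (1 - δ) * kde N ψ h w₀ x v +
      δ * localMaxwellian 1 (cT N ψ w₀ x + h ^ 2) (cU N ψ w₀ x) v := rfl
  rw [hcell1, hcell0]
  have h1δ : 0 ≤ 1 - δ := by linarith
  nlinarith [mul_le_mul_of_nonneg_left step2 h1δ]

/-- **THE MIXTURE BOUND, INTEGRATED**: `∫ breg(f̂, f̂⁰) ≤ (1−δ) W⁻¹ (cwᵢ + cwⱼ) |vᵢ − vᵢ⁰|²/(2h²) + δ KL(M‖M⁰)`,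
`KL(M‖M⁰) = (3/2)(s/s⁰ − 1 − log(s/s⁰)) + |ū − ū⁰|²/(2 s⁰)`, `s = θ̄ + h²`. -/
theorem cellBreg_le_mixture (hψ : ∀ y, 0 ≤ ψ N y) (hh : 0 < h) (hδ : 0 < δ) (hδ1 : δ ≤ 1) (hij : i ≠ j) :
    ∫ v, (cellLaw N ψ h δ w x v * (log (cellLaw N ψ h δ w x v) - log (cellLaw N ψ h δ (collidePair 𝕋G i j w) x v)) -
        cellLaw N ψ h δ w x v + cellLaw N ψ h δ (collidePair 𝕋G i j w) x v) ≤
      (1 - δ) * ((cW N ψ w x)⁻¹ * ((cw N ψ w x i + cw N ψ w x j) *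
        (‖(w i).2 - ((collidePair 𝕋G i j w) i).2‖ ^ 2 / (2 * h ^ 2)))) +
      δ * (3 / 2 * ((cT N ψ w x + h ^ 2) / (cT N ψ (collidePair 𝕋G i j w) x + h ^ 2) - 1 -
          log ((cT N ψ w x + h ^ 2) / (cT N ψ (collidePair 𝕋G i j w) x + h ^ 2))) +
        ‖cU N ψ w x - cU N ψ (collidePair 𝕋G i j w) x‖ ^ 2 / (2 * (cT N ψ (collidePair 𝕋G i j w) x + h ^ 2))) := by
  have hθ₁ := theta_pos (h := h) w x hψ hh
  have hθ₀ := theta_pos (h := h) (collidePair 𝕋G i j w) x hψ hh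
  have h1 := vel_add_vel_collidePair w hij
  set w₀ := collidePair 𝕋G i j w with hw₀
  -- integrable majorant, in lambda form
  have iGi := integrable_breg_gauss hh (w i).2 (w₀ i).2
  have iGj := integrable_breg_gauss hh (w j).2 (w₀ j).2
  have iM := integrable_breg_lM hθ₀ hθ₁ (cU N ψ w₀ x) (cU N ψ w x)
  have iA : Integrable fun v => cw N ψ w x i * (gauss h (w i).2 v * (log (gauss h (w i).2 v) - log (gauss h (w₀ i).2 v)) -
      gauss h (w i).2 v + gauss h (w₀ i).2 v) := iGi.const_mul _
  have iB : Integrable fun v => cw N ψ w x j * (gauss h (w j).2 v * (log (gauss h (w j).2 v) - log (gauss h (w₀ j).2 v)) -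
      gauss h (w j).2 v + gauss h (w₀ j).2 v) := iGj.const_mul _
  have iAB : Integrable fun v => cw N ψ w x i * (gauss h (w i).2 v * (log (gauss h (w i).2 v) - log (gauss h (w₀ i).2 v)) -
      gauss h (w i).2 v + gauss h (w₀ i).2 v) +
      cw N ψ w x j * (gauss h (w j).2 v * (log (gauss h (w j).2 v) - log (gauss h (w₀ j).2 v)) -
      gauss h (w j).2 v + gauss h (w₀ j).2 v) := iA.add iB
  have iC : Integrable fun v => (1 - δ) * ((cW N ψ w x)⁻¹ *
      (cw N ψ w x i * (gauss h (w i).2 v * (log (gauss h (w i).2 v) - log (gauss h (w₀ i).2 v)) -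
        gauss h (w i).2 v + gauss h (w₀ i).2 v) +
      cw N ψ w x j * (gauss h (w j).2 v * (log (gauss h (w j).2 v) - log (gauss h (w₀ j).2 v)) -
        gauss h (w j).2 v + gauss h (w₀ j).2 v))) := (iAB.const_mul _).const_mul _
  have iD : Integrable fun v => δ * (localMaxwellian 1 (cT N ψ w x + h ^ 2) (cU N ψ w x) v *
      (log (localMaxwellian 1 (cT N ψ w x + h ^ 2) (cU N ψ w x) v) -
        log (localMaxwellian 1 (cT N ψ w₀ x + h ^ 2) (cU N ψ w₀ x) v)) -
      localMaxwellian 1 (cT N ψ w x + h ^ 2) (cU N ψ w x) v +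
      localMaxwellian 1 (cT N ψ w₀ x + h ^ 2) (cU N ψ w₀ x) v) := iM.const_mul δ
  have imaj : Integrable fun v => (1 - δ) * ((cW N ψ w x)⁻¹ *
      (cw N ψ w x i * (gauss h (w i).2 v * (log (gauss h (w i).2 v) - log (gauss h (w₀ i).2 v)) -
        gauss h (w i).2 v + gauss h (w₀ i).2 v) +
      cw N ψ w x j * (gauss h (w j).2 v * (log (gauss h (w j).2 v) - log (gauss h (w₀ j).2 v)) -
        gauss h (w j).2 v + gauss h (w₀ j).2 v))) +
      δ * (localMaxwellian 1 (cT N ψ w x + h ^ 2) (cU N ψ w x) v *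
      (log (localMaxwellian 1 (cT N ψ w x + h ^ 2) (cU N ψ w x) v) -
        log (localMaxwellian 1 (cT N ψ w₀ x + h ^ 2) (cU N ψ w₀ x) v)) -
      localMaxwellian 1 (cT N ψ w x + h ^ 2) (cU N ψ w x) v +
      localMaxwellian 1 (cT N ψ w₀ x + h ^ 2) (cU N ψ w₀ x) v) := iC.add iD
  have hle := integral_mono (integrable_breg_cellLaw x hψ hh hδ hδ1 w₀ w) imaj fun v =>
    breg_cellLaw_le_pointwise w x hψ hh hδ.le hδ1 hij v
  refine hle.trans (le_of_eq ?_)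
  rw [integral_add iC iD]
  simp only [integral_const_mul]
  rw [integral_add iA iB]
  simp only [integral_const_mul]
  rw [integral_breg_gauss hh, integral_breg_gauss hh, integral_breg_lM hθ₀ hθ₁]
  -- `|v_j − v_j⁰| = |v_i − v_i⁰|` (pair momentum)
  have hj : ‖(w j).2 - (w₀ j).2‖ ^ 2 = ‖(w i).2 - (w₀ i).2‖ ^ 2 := by
    have : (w j).2 - (w₀ j).2 = -((w i).2 - (w₀ i).2) := by
      rw [neg_sub, sub_eq_sub_iff_add_eq_add, add_comm, ← h1]
    rw [this, norm_neg]
  rw [hj]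
  ring

/-- **THE LONELY (UNIVERSAL) BOUND**: `W · ∫ breg(f̂, f̂⁰) ≤ 5 (cwᵢ + cwⱼ) E₀ / h²`,
`E₀ = |vᵢ⁰ − ū⁰|² + |vⱼ⁰ − ū⁰|²` (pre-collisional velocities and cell velocity). -/
theorem cW_mul_cellBreg_le_lonely (hψ : ∀ y, 0 ≤ ψ N y) (hh : 0 < h) (hδ : 0 < δ) (hδ1 : δ ≤ 1) (hij : i ≠ j) :
    cW N ψ w x * ∫ v, (cellLaw N ψ h δ w x v * (log (cellLaw N ψ h δ w x v) - log (cellLaw N ψ h δ (collidePair 𝕋G i j w) x v)) -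
        cellLaw N ψ h δ w x v + cellLaw N ψ h δ (collidePair 𝕋G i j w) x v) ≤
      5 * (cw N ψ w x i + cw N ψ w x j) *
        (‖((collidePair 𝕋G i j w) i).2 - cU N ψ (collidePair 𝕋G i j w) x‖ ^ 2 +
          ‖((collidePair 𝕋G i j w) j).2 - cU N ψ (collidePair 𝕋G i j w) x‖ ^ 2) / h ^ 2 := by
  have hW0 := cW_nonneg w x hψ
  have hh2 : 0 < h ^ 2 := by positivity
  by_cases hS : cW N ψ w x = 0
  · rw [hS, zero_mul]
    exact div_nonneg (mul_nonneg (mul_nonneg (by norm_num) (add_nonneg (cw_nonneg w x hψ i) (cw_nonneg w x hψ j)))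
      (by positivity)) hh2.le
  have hSpos : 0 < cW N ψ w x := lt_of_le_of_ne hW0 (Ne.symm hS)
  -- ingredients (stated before folding the abbreviations)
  have hθ₁ : 0 < cT N ψ w x + h ^ 2 := theta_pos (h := h) w x hψ hh
  have hθ₀ : 0 < cT N ψ (collidePair 𝕋G i j w) x + h ^ 2 := theta_pos (h := h) (collidePair 𝕋G i j w) x hψ hh
  have hs₀h : h ^ 2 ≤ cT N ψ (collidePair 𝕋G i j w) x + h ^ 2 := h2_le_theta (collidePair 𝕋G i j w) x hψ
  have hs₁h : h ^ 2 ≤ cT N ψ w x + h ^ 2 := h2_le_theta w x hψ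
  have hmix := cellBreg_le_mixture w x hψ hh hδ hδ1 hij
  have hKL := kl_lM_le_general hθ₀ hθ₁ (cU N ψ (collidePair 𝕋G i j w) x) (cU N ψ w x)
  have hvel := norm_sq_vel_sub_le w hij (cU N ψ (collidePair 𝕋G i j w) x)
  have hdU := cW_sq_mul_norm_cU_sub_sq_le w x hψ hij (cU N ψ (collidePair 𝕋G i j w) x)
  have hdθ := cW_mul_abs_cT_sub_le w x hψ hij
  have hdW := abs_cw_sub_cw_le w x hψ i j
  have hda := abs_cw_sub_cw_le_add w x hψ i j
  -- abbreviations
  set w₀ := collidePair 𝕋G i j w with hw₀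
  set U₀ := cU N ψ w₀ x with hU₀
  set E : ℝ := ‖(w₀ i).2 - U₀‖ ^ 2 + ‖(w₀ j).2 - U₀‖ ^ 2 with hEdef
  set s₁ : ℝ := cT N ψ w x + h ^ 2 with hs₁
  set s₀ : ℝ := cT N ψ w₀ x + h ^ 2 with hs₀
  set a : ℝ := cw N ψ w x i + cw N ψ w x j with ha
  set d : ℝ := cw N ψ w x i - cw N ψ w x j with hd
  have ha0 : 0 ≤ a := add_nonneg (cw_nonneg w x hψ i) (cw_nonneg w x hψ j)
  have hE0 : 0 ≤ E := by positivity
  have hmin : h ^ 2 ≤ min s₀ s₁ := le_min hs₀h hs₁h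
  have hss : s₁ - s₀ = cT N ψ w x - cT N ψ w₀ x := by rw [hs₁, hs₀]; ring
  -- W · KL ≤ (5/2)|d| E/h² + 2 |d| E/h²
  have t1 : cW N ψ w x * (3 / 2 * (|s₁ - s₀| / min s₀ s₁)) ≤ 5 / 2 * |d| * E / h ^ 2 := by
    have h1 : |s₁ - s₀| / min s₀ s₁ ≤ |s₁ - s₀| / h ^ 2 :=
      div_le_div_of_nonneg_left (abs_nonneg _) hh2 hmin
    have h2 : cW N ψ w x * |s₁ - s₀| ≤ 5 / 3 * |d| * E := by rw [hss]; linarith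
    calc cW N ψ w x * (3 / 2 * (|s₁ - s₀| / min s₀ s₁)) ≤ cW N ψ w x * (3 / 2 * (|s₁ - s₀| / h ^ 2)) :=
          mul_le_mul_of_nonneg_left (mul_le_mul_of_nonneg_left h1 (by norm_num)) hW0
      _ = 3 / 2 * (cW N ψ w x * |s₁ - s₀|) / h ^ 2 := by ring
      _ ≤ 3 / 2 * (5 / 3 * |d| * E) / h ^ 2 := by gcongr
      _ = 5 / 2 * |d| * E / h ^ 2 := by ring
  have t2 : cW N ψ w x * (‖cU N ψ w x - U₀‖ ^ 2 / (2 * s₀)) ≤ 2 * |d| * E / h ^ 2 := by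
    have h1 : cW N ψ w x * (cW N ψ w x * ‖cU N ψ w x - U₀‖ ^ 2) ≤ cW N ψ w x * (4 * |d| * E) := by
      have : 4 * d ^ 2 * E ≤ 4 * (|d| * cW N ψ w x) * E := by
        have e : d ^ 2 = |d| * |d| := by rw [← sq_abs, sq]
        rw [e]; gcongr
      calc cW N ψ w x * (cW N ψ w x * ‖cU N ψ w x - U₀‖ ^ 2) = cW N ψ w x ^ 2 * ‖cU N ψ w x - U₀‖ ^ 2 := by ring
        _ ≤ 4 * d ^ 2 * E := hdU
        _ ≤ 4 * (|d| * cW N ψ w x) * E := this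
        _ = cW N ψ w x * (4 * |d| * E) := by ring
    have h2 : cW N ψ w x * ‖cU N ψ w x - U₀‖ ^ 2 ≤ 4 * |d| * E := le_of_mul_le_mul_left h1 hSpos
    have h3 : ‖cU N ψ w x - U₀‖ ^ 2 / (2 * s₀) ≤ ‖cU N ψ w x - U₀‖ ^ 2 / (2 * h ^ 2) :=
      div_le_div_of_nonneg_left (sq_nonneg _) (by positivity) (by linarith)
    calc cW N ψ w x * (‖cU N ψ w x - U₀‖ ^ 2 / (2 * s₀)) ≤ cW N ψ w x * (‖cU N ψ w x - U₀‖ ^ 2 / (2 * h ^ 2)) :=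
          mul_le_mul_of_nonneg_left h3 hW0
      _ = cW N ψ w x * ‖cU N ψ w x - U₀‖ ^ 2 / (2 * h ^ 2) := by ring
      _ ≤ 4 * |d| * E / (2 * h ^ 2) := by gcongr
      _ = 2 * |d| * E / h ^ 2 := by field_simp; ring
  -- W (1−δ) W⁻¹ a |Δv|²/(2h²) ≤ (1−δ) a · 2E/h²
  have t3 : cW N ψ w x * ((1 - δ) * ((cW N ψ w x)⁻¹ * (a * (‖(w i).2 - (w₀ i).2‖ ^ 2 / (2 * h ^ 2))))) ≤
      (1 - δ) * a * (2 * E) / h ^ 2 := by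
    have e : cW N ψ w x * ((1 - δ) * ((cW N ψ w x)⁻¹ * (a * (‖(w i).2 - (w₀ i).2‖ ^ 2 / (2 * h ^ 2))))) =
        (1 - δ) * a * ‖(w i).2 - (w₀ i).2‖ ^ 2 / (2 * h ^ 2) := by field_simp
    rw [e, div_le_div_iff₀ (by positivity) hh2]
    have h1δ : 0 ≤ 1 - δ := by linarith
    have : (1 - δ) * a * ‖(w i).2 - (w₀ i).2‖ ^ 2 ≤ (1 - δ) * a * (4 * E) :=
      mul_le_mul_of_nonneg_left hvel (mul_nonneg h1δ ha0)
    calc (1 - δ) * a * ‖(w i).2 - (w₀ i).2‖ ^ 2 * h ^ 2 ≤ (1 - δ) * a * (4 * E) * h ^ 2 :=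
        mul_le_mul_of_nonneg_right this hh2.le
      _ = (1 - δ) * a * (2 * E) * (2 * h ^ 2) := by ring
  -- assemble
  have hsum : cW N ψ w x * ∫ v, (cellLaw N ψ h δ w x v * (log (cellLaw N ψ h δ w x v) - log (cellLaw N ψ h δ w₀ x v)) -
      cellLaw N ψ h δ w x v + cellLaw N ψ h δ w₀ x v) ≤
      (1 - δ) * a * (2 * E) / h ^ 2 + δ * (5 / 2 * |d| * E / h ^ 2 + 2 * |d| * E / h ^ 2) := by
    have h1 := mul_le_mul_of_nonneg_left hmix hW0
    have h3 : cW N ψ w x * (3 / 2 * (s₁ / s₀ - 1 - log (s₁ / s₀)) + ‖cU N ψ w x - U₀‖ ^ 2 / (2 * s₀)) ≤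
        5 / 2 * |d| * E / h ^ 2 + 2 * |d| * E / h ^ 2 :=
      calc cW N ψ w x * (3 / 2 * (s₁ / s₀ - 1 - log (s₁ / s₀)) + ‖cU N ψ w x - U₀‖ ^ 2 / (2 * s₀))
          ≤ cW N ψ w x * (3 / 2 * (|s₁ - s₀| / min s₀ s₁) + ‖cU N ψ w x - U₀‖ ^ 2 / (2 * s₀)) :=
            mul_le_mul_of_nonneg_left hKL hW0
        _ = cW N ψ w x * (3 / 2 * (|s₁ - s₀| / min s₀ s₁)) + cW N ψ w x * (‖cU N ψ w x - U₀‖ ^ 2 / (2 * s₀)) := by ring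
        _ ≤ 5 / 2 * |d| * E / h ^ 2 + 2 * |d| * E / h ^ 2 := add_le_add t1 t2
    have h2 : cW N ψ w x * (δ * (3 / 2 * (s₁ / s₀ - 1 - log (s₁ / s₀)) + ‖cU N ψ w x - U₀‖ ^ 2 / (2 * s₀))) ≤
        δ * (5 / 2 * |d| * E / h ^ 2 + 2 * |d| * E / h ^ 2) := by
      rw [mul_left_comm]
      exact mul_le_mul_of_nonneg_left h3 hδ.le
    calc cW N ψ w x * ∫ v, (cellLaw N ψ h δ w x v * (log (cellLaw N ψ h δ w x v) - log (cellLaw N ψ h δ w₀ x v)) -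
          cellLaw N ψ h δ w x v + cellLaw N ψ h δ w₀ x v)
        ≤ cW N ψ w x * ((1 - δ) * ((cW N ψ w x)⁻¹ * (a * (‖(w i).2 - (w₀ i).2‖ ^ 2 / (2 * h ^ 2)))) +
            δ * (3 / 2 * (s₁ / s₀ - 1 - log (s₁ / s₀)) + ‖cU N ψ w x - U₀‖ ^ 2 / (2 * s₀))) := h1
      _ = cW N ψ w x * ((1 - δ) * ((cW N ψ w x)⁻¹ * (a * (‖(w i).2 - (w₀ i).2‖ ^ 2 / (2 * h ^ 2))))) +
            cW N ψ w x * (δ * (3 / 2 * (s₁ / s₀ - 1 - log (s₁ / s₀)) + ‖cU N ψ w x - U₀‖ ^ 2 / (2 * s₀))) := by ring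
      _ ≤ (1 - δ) * a * (2 * E) / h ^ 2 + δ * (5 / 2 * |d| * E / h ^ 2 + 2 * |d| * E / h ^ 2) := add_le_add t3 h2
  refine hsum.trans ?_
  have key : (1 - δ) * a * (2 * E) + δ * (5 / 2 * |d| * E + 2 * |d| * E) ≤ 5 * a * E := by
    have hdaE : |d| * E ≤ a * E := mul_le_mul_of_nonneg_right hda hE0
    have k1 : δ * (5 / 2 * |d| * E + 2 * |d| * E) ≤ δ * (9 / 2 * (a * E)) :=
      mul_le_mul_of_nonneg_left (by linarith) hδ.le
    have k2 : δ * (a * E) ≤ 1 * (a * E) := mul_le_mul_of_nonneg_right hδ1 (mul_nonneg ha0 hE0)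
    have k3 : 0 ≤ a * E := mul_nonneg ha0 hE0
    nlinarith [k1, k2, k3]
  calc (1 - δ) * a * (2 * E) / h ^ 2 + δ * (5 / 2 * |d| * E / h ^ 2 + 2 * |d| * E / h ^ 2)
      = ((1 - δ) * a * (2 * E) + δ * (5 / 2 * |d| * E + 2 * |d| * E)) / h ^ 2 := by ring
    _ ≤ 5 * a * E / h ^ 2 := div_le_div_of_nonneg_right key hh2.le

end PerContact

/-- Registered anchor of this helper file (`--supports stmt-AtomisticToContinuum-14868`, helper of
`stub_perContact`): the lonely (universal) bound of the per-cell Bregman remainder of one contact,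
`W ∫ breg(f̂, f̂⁰) ≤ 5 (cwᵢ + cwⱼ) E₀ / h²`. -/
theorem bhPerContact_lonely_anchor : ∀ (N : ℕ) (ψ : ℕ → T3 → ℝ) (h δ : ℝ) (w : Cfg N) (x : T3) (i j : Fin (N + 1)), (∀ y, 0 ≤ ψ N y) → 0 < h → 0 < δ → δ ≤ 1 → i ≠ j → cW N ψ w x * ∫ v, (cellLaw N ψ h δ w x v * (Real.log (cellLaw N ψ h δ w x v) - Real.log (cellLaw N ψ h δ (Literature.Analysis.FluidPDE.collidePair (Literature.Analysis.FluidPDE.Torus.geometry (Fin 3)) i j w) x v)) - cellLaw N ψ h δ w x v + cellLaw N ψ h δ (Literature.Analysis.FluidPDE.collidePair (Literature.Analysis.FluidPDE.Torus.geometry (Fin 3)) i j w) x v) ≤ 5 * (cw N ψ w x i + cw N ψ w x j) * (‖((Literature.Analysis.FluidPDE.collidePair (Literature.Analysis.FluidPDE.Torus.geometry (Fin 3)) i j w) i).2 - cU N ψ (Literature.Analysis.FluidPDE.collidePair (Literature.Analysis.FluidPDE.Torus.geometry (Fin 3)) i j w) x‖ ^ 2 + ‖((Literature.Analysis.FluidPDE.collidePair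 (Literature.Analysis.FluidPDE.Torus.geometry (Fin 3)) i j w) j).2 - cU N ψ (Literature.Analysis.FluidPDE.collidePair (Literature.Analysis.FluidPDE.Torus.geometry (Fin 3)) i j w) x‖ ^ 2) / h ^ 2 :=
  fun _ _ _ _ w x _ _ hψ hh hδ hδ1 hij => PerContact.cW_mul_cellBreg_le_lonely w x hψ hh hδ hδ1 hij

end

end Summit.AtomisticToContinuum.HydrodynamicLimit.Theorems.BlockHDissipation
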